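/-
Copyright: the m5 harness (cell B2b-5 `b2b-lgcu-borel`, generation 22).  Sorry-free; axioms: propext,
Classical.choice, Quot.sound.  VALUE = THEOREM (a budget-free, TPP-free configuration exclusion on the
level-one slice), NOT summit progress: the crux `SubgroupIdentityDesigns`
(stmt-MatrixMultiplication-14079) is untouched and remains open.
-/
import Mathlib
import Summits.MatrixMultiplication.MatrixMultiplication.Theorems.SubgroupIdentityDesigns.Negative.GLmLevelOneCertificates
import Summits.MatrixMultiplication.MatrixMultiplication.Theorems.SubgroupIdentityDesigns.Negative.SummandTransport

/-!
# Non-square reflections: the sign-twisted orthogonal group lies in no member (`p ≡ 3 mod 4`)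

Route `LevelGradedCohnUmans`, crux `SubgroupIdentityDesigns`, level-one slice, `m ≥ 3`.

THE CONFIGURATION.  For `b ∈ 𝔽_p^m` with `Q(b) = b ⬝ b` put `R_b = 1 − (2/Q(b)) b bᵀ` (`reflMat`,
`refl`; the orthogonal reflection in the hyperplane `b^⊥` when `Q(b) ≠ 0`, the identity when
`Q(b) = 0`).  `R_b² = 1`, `det R_b = −1` (`Q(b) ≠ 0`), and `R_b u = u` whenever `b ⬝ u = 0`.
The NON-SQUARE REFLECTIONS `{R_b : Q(b) ∉ (𝔽_p)²}` of `𝔽_p³` generate the index-two subgroup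
`K_p⁻ = Ω₃(𝔽_p) ∪ −(SO₃(𝔽_p) ∖ Ω₃(𝔽_p)) ≅ PGL₂(𝔽_p)` of `O₃(𝔽_p)` — the SIGN-TWISTED adjoint group
`{χ(det g) · Ad(g)}` (`χ` the quadratic character), NOT `SO₃(𝔽_p)` (checked for `p ≤ 13`,
code/g22/reflection_cover_check.py of the cell).

**THEOREM** (`no_design_mem₁/₂/₃`, `p ≡ 3 (mod 4)`, i.e. `−1` a non-square; GL₃ and, through
`SummandTransport.design_comap`, every `GL_m`, `m ≥ 3`, on any three coordinates:
`no_design_mem₁/₂/₃_all`).  No member of a triple `(H₁,H₂,H₃) ≤ GL_m(𝔽_p)³` carrying a level-one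
identity design contains all non-square reflections of three coordinates; cover form
`no_design_of_cover`: `⟨R_b : Q(b) non-square⟩ ∖ 1 ⊆ H₁H₂H₃` is impossible.  No TPP, no budget: every `ε`.

PROOF = a determinant cover (`GLmLevelOneCertificates.no_levelOne_design_of_detFixers_gl`): for
`p ≡ 3 (mod 4)` EVERY `u ≠ 0` is fixed by a non-square reflection, i.e. has some `b ⊥ u` with `Q(b)`
a non-square (`exists_orth_nonsquare`, explicit: `Q(u) = 0` ⇒ `b = u × e_i` with `u_i ≠ 0`,
`Q(b) = −u_i²`; else pick `i` with `D = Q(u) − u_i² ≠ 0` (all three vanish only if `2Q(u) = 0`),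
`c = u × e_i` (`Q(c) = D`), `d = u_i u − Q(u) e_i` (`Q(d) = Q(u) D`, `c ⊥ d`, both `⊥ u`): `b = c` if
`D` is a non-square, `b = d` if `D` is a square and `Q(u)` is not, and `b = x c + (y/s) d` with
`x² + y² = −1/D` (`ZMod.sq_add_sq`), `Q(u) = s²`, `Q(b) = −1` otherwise).

THE GENERIC FORM `no_design_of_fixCover` is dimension-free: a fix-cover of `𝔽_p^m ∖ 0` by
non-square reflections excludes `⟨R_b : Q(b) non-square⟩` from every member.  For `m ≥ 4` such a
cover exists for EVERY odd `p` (`u^⊥ / (u^⊥ ∩ 𝔽_p u)` is non-degenerate of dimension `≥ 2`, hence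
represents every non-zero class) — supplied for four coordinates by a companion file; in dimension
`3` it exists iff `p ≡ 3 (mod 4)`:

WHY `p ≡ 3 (mod 4)` ONLY (`m = 3`), AND WHAT IS LEFT.  For `p ≡ 1 (mod 4)` the isotropic vectors are
fixed by NO element of determinant `−1` of `K_p⁻` (on `u^⊥ ∖ 𝔽_p u`, `Q ≡ −u_i²` is a square), and
indeed no linear character of `K_p⁻` is missing from `ℂ[𝔽_p³ ∖ 0]`: the exact class-function test
(code/g22/signed_orthogonal_family.py, twisted_cusp_form.py) shows that `K_p⁻` is a NON-CARRIER for
every odd `p ≤ 23` with exactly `⌊(p+1)/4⌋` irreducibles missing — for `p ≡ 3 (mod 4)` the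
determinant and the `(p−3)/4` principal series `π(μ)`, `μ(−1) = −1`; for `p ≡ 1 (mod 4)` the
`(p−1)/4` CUSPIDAL `σ(θ)`, `θ(ι) = 1` — and for `p ≡ 1 (mod 4)` the canonical certificate is the
integer class function `ν = ((p−1)²/4)[1] − ((p−1)/4)[unipotent] − ((p−1)/2)[−Ad(elliptic
involution)] + [elliptic regular]` (verified `p = 5, 13, 17`), a twisted analogue of the cusp form
of `CuspidalObstruction`; its formalisation (coset identities over the stabilisers `U`,
`N`-type groups of order `p ± 1`) is OPEN.  At `(m,p) = (3,5)` this `K₅⁻ ≅ S₅` (order 120) is the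
one minimal non-carrier class of the completed catalogue not yet covered by an all-`p` theorem.

HONEST SCOPE.  Configuration exclusions; no `(p,m,ε)` cell is emptied.
-/

set_option linter.dupNamespace false

noncomputable section

open scoped BigOperators Classical Matrix

namespace Summit.MatrixMultiplication.MatrixMultiplication.Theorems.SubgroupIdentityDesigns.Negative
namespace NonsquareReflections

open Summit.MatrixMultiplication.MatrixMultiplication.Theorems.LieRankDesigns.Negative (GLm Mat)
open SummandTransport (emb design_comap)

variable {p : ℕ} [hp : Fact p.Prime] {m : ℕ}

/-! ## Reflections -/

/-- The reflection matrix `R_b = 1 − (2/Q(b)) b bᵀ`, `Q(b) = b ⬝ b` (the identity if `Q(b) = 0`). -/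
def reflMat (b : Fin m → ZMod p) : Mat p m :=
  1 - Matrix.vecMulVec ((2 / (b ⬝ᵥ b)) • b) b

/-- `R_b² = 1`. -/
theorem reflMat_mul_self (b : Fin m → ZMod p) : reflMat b * reflMat b = 1 := by
  unfold reflMat
  set c : ZMod p := 2 / (b ⬝ᵥ b) with hc
  set V : Mat p m := Matrix.vecMulVec (c • b) b with hV
  have hVV : V * V = (c * (b ⬝ᵥ b)) • V := by
    rw [hV, Matrix.vecMulVec_mul_vecMulVec, dotProduct_smul, smul_eq_mul, Matrix.vecMulVec_smul]
  rcases eq_or_ne (b ⬝ᵥ b) 0 with h | h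
  · have hc0 : c = 0 := by rw [hc, h, div_zero]
    have hV0 : V = 0 := by
      rw [hV, hc0, zero_smul]
      ext i j
      simp [Matrix.vecMulVec_apply]
    rw [hV0, sub_zero, mul_one]
  · have h2 : c * (b ⬝ᵥ b) = 2 := by rw [hc, div_mul_cancel₀ _ h]
    simp only [sub_mul, mul_sub, one_mul, mul_one, hVV, h2, two_smul]
    abel

/-- The reflection as an element of `GL_m(𝔽_p)`. -/
def refl (b : Fin m → ZMod p) : GLm p m :=
  ⟨reflMat b, reflMat b, reflMat_mul_self b, reflMat_mul_self b⟩

/-- Underlying matrix of `refl b`. -/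
@[simp] theorem coe_refl (b : Fin m → ZMod p) : ((refl b : GLm p m) : Mat p m) = reflMat b := rfl

/-- `R_b` fixes the hyperplane `b^⊥`. -/
theorem reflMat_mulVec (b u : Fin m → ZMod p) (hbu : b ⬝ᵥ u = 0) : (reflMat b).mulVec u = u := by
  unfold reflMat
  rw [Matrix.sub_mulVec, Matrix.one_mulVec, Matrix.vecMulVec_mulVec, hbu, MulOpposite.op_zero,
    zero_smul, sub_zero]

/-- `det R_b = −1` for anisotropic `b`. -/
theorem det_reflMat (b : Fin m → ZMod p) (hQ : b ⬝ᵥ b ≠ 0) : (reflMat b).det = -1 := by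
  unfold reflMat
  rw [sub_eq_add_neg, ← Matrix.neg_vecMulVec, Matrix.vecMulVec_eq Unit,
    Matrix.det_one_add_replicateCol_mul_replicateRow, dotProduct_neg, dotProduct_smul, smul_eq_mul,
    div_mul_cancel₀ _ hQ]
  norm_num

/-! ## The cover: for `p ≡ 3 (mod 4)` every non-zero vector of `𝔽_p³` has a non-square reflection fixing it -/

/-- `Q(x c + y d) = x² Q(c) + y² Q(d)` for `c ⊥ d`. -/
theorem dot_combo (c d : Fin 3 → ZMod p) (hcd : c ⬝ᵥ d = 0) (x y : ZMod p) :
    (x • c + y • d) ⬝ᵥ (x • c + y • d) = x * x * (c ⬝ᵥ c) + y * y * (d ⬝ᵥ d) := by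
  have hdc : d ⬝ᵥ c = 0 := by rw [dotProduct_comm]; exact hcd
  simp only [add_dotProduct, dotProduct_add, smul_dotProduct, dotProduct_smul, smul_eq_mul, hcd, hdc]
  ring

/-- `¬ IsSquare (-1)` forces `p ≠ 2`. -/
theorem two_ne (hm1 : ¬ IsSquare (-1 : ZMod p)) : p ≠ 2 := by
  intro h2
  apply hm1
  have h' : ((2 : ℕ) : ZMod p) = 0 := by rw [ZMod.natCast_eq_zero_iff, h2]
  have h'' : (2 : ZMod p) = 0 := by exact_mod_cast h'
  exact ⟨1, by linear_combination -h''⟩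

/-- `−1 ≠ 1` when `−1` is a non-square. -/
theorem neg_one_ne_one' (hm1 : ¬ IsSquare (-1 : ZMod p)) : (-1 : ZMod p) ≠ 1 :=
  fun h => hm1 ⟨1, by rw [h, mul_one]⟩

/-- **THE COVER LEMMA.**  For `p ≡ 3 (mod 4)` (`−1` a non-square) every `u ≠ 0` in `𝔽_p³` is
orthogonal to some `b` with `Q(b)` a non-square. -/
theorem exists_orth_nonsquare (hm1 : ¬ IsSquare (-1 : ZMod p)) (u : Fin 3 → ZMod p) (hu : u ≠ 0) :
    ∃ b : Fin 3 → ZMod p, b ⬝ᵥ u = 0 ∧ ¬ IsSquare (b ⬝ᵥ b) := by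
  have hp2 := two_ne hm1
  set Q := u ⬝ᵥ u with hQ
  -- the vectors `c_i = u × e_i`: orthogonal to `u`, `Q(c_i) = Q − u_i²`
  have hc_orth : ∀ i : Fin 3, (u ⨯₃ Pi.single i 1) ⬝ᵥ u = 0 := fun i => by
    rw [dotProduct_comm]; exact dot_self_cross u _
  have hc_Q : ∀ i : Fin 3, (u ⨯₃ Pi.single i 1) ⬝ᵥ (u ⨯₃ Pi.single i 1) = Q - u i * u i :=
    fun i => by
      simp only [cross_dot_cross, dotProduct_single, single_dotProduct, Pi.single_eq_same, mul_one,
        one_mul, hQ]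
  rcases eq_or_ne Q 0 with hQ0 | hQ0
  · -- isotropic `u`: `b = u × e_i` with `u_i ≠ 0`, `Q(b) = -u_i²`
    obtain ⟨i, hi⟩ : ∃ i, u i ≠ 0 := by
      by_contra h
      simp only [not_exists, not_not] at h
      exact hu (funext h)
    refine ⟨u ⨯₃ Pi.single i 1, hc_orth i, ?_⟩
    rw [hc_Q i, hQ0, zero_sub]
    rintro ⟨r, hr⟩
    apply hm1
    refine ⟨r / u i, ?_⟩
    field_simp
    linear_combination hr
  · -- anisotropic `u`: some `D = Q − u_i² ≠ 0`
    obtain ⟨i, hi⟩ : ∃ i, Q - u i * u i ≠ 0 := by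
      by_contra h
      simp only [not_exists, not_not, sub_eq_zero] at h
      have h3 : Q = u 0 * u 0 + u 1 * u 1 + u 2 * u 2 := by
        rw [hQ, dotProduct, Fin.sum_univ_three]
      have h2Q : (2 : ZMod p) * Q = 0 := by
        linear_combination (h 0) + (h 1) + (h 2) - h3
      rcases mul_eq_zero.mp h2Q with h2 | h0
      · have h' : ((2 : ℕ) : ZMod p) = 0 := by exact_mod_cast h2
        rw [ZMod.natCast_eq_zero_iff] at h'
        exact hp2 ((Nat.prime_dvd_prime_iff_eq hp.out Nat.prime_two).mp h')
      · exact hQ0 h0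
    set D := Q - u i * u i with hD
    set c := u ⨯₃ Pi.single i 1 with hc
    set d := u i • u - Q • (Pi.single i 1 : Fin 3 → ZMod p) with hd
    have hcu : c ⬝ᵥ u = 0 := hc_orth i
    have hcc : c ⬝ᵥ c = D := hc_Q i
    have hdu : d ⬝ᵥ u = 0 := by
      rw [hd, sub_dotProduct, smul_dotProduct, smul_dotProduct, single_dotProduct, smul_eq_mul,
        smul_eq_mul, one_mul, ← hQ]
      ring
    have hce : c ⬝ᵥ Pi.single i 1 = 0 := by
      rw [hc, dotProduct_comm]; exact dot_cross_self u _
    have hcd : c ⬝ᵥ d = 0 := by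
      rw [hd, dotProduct_sub, dotProduct_smul, dotProduct_smul, hcu, hce, smul_zero, smul_zero,
        sub_zero]
    have hdd : d ⬝ᵥ d = Q * D := by
      rw [hd, sub_dotProduct, dotProduct_sub, dotProduct_sub, smul_dotProduct, smul_dotProduct,
        smul_dotProduct, smul_dotProduct, dotProduct_smul, dotProduct_smul, dotProduct_smul,
        dotProduct_smul, ← hQ, dotProduct_single, single_dotProduct, single_dotProduct,
        Pi.single_eq_same]
      simp only [smul_eq_mul, mul_one, one_mul, hD]
      ring
    by_cases hDsq : IsSquare D
    · obtain ⟨r, hr⟩ := hDsq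
      have hr0 : r ≠ 0 := by rintro rfl; exact hi (by rw [hr, mul_zero])
      by_cases hQsq : IsSquare Q
      · -- `Q = s²`, `D = r²`: `b = x c + (y/s) d` with `x² + y² = -1/D`, `Q(b) = -1`
        obtain ⟨s, hs⟩ := hQsq
        have hs0 : s ≠ 0 := by rintro rfl; exact hQ0 (by rw [hs, mul_zero])
        obtain ⟨x, y, hxy⟩ := ZMod.sq_add_sq p (-D⁻¹)
        refine ⟨x • c + (y / s) • d, ?_, ?_⟩
        · rw [add_dotProduct, smul_dotProduct, smul_dotProduct, hcu, hdu, smul_zero, smul_zero,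
            add_zero]
        · rw [dot_combo c d hcd, hcc, hdd]
          have hval : x * x * D + y / s * (y / s) * (Q * D) = -1 := by
            rw [hs]
            field_simp
            have hD0 : D ≠ 0 := hi
            have : (x ^ 2 + y ^ 2) * D = -1 := by
              rw [hxy]; field_simp
            linear_combination this
          rw [hval]
          exact hm1
      · -- `Q` a non-square, `D = r²`: `b = d`, `Q(d) = Q r²`
        refine ⟨d, hdu, ?_⟩
        rw [hdd, hr]
        rintro ⟨t, ht⟩
        apply hQsq
        refine ⟨t / r, ?_⟩
        field_simp
        linear_combination ht
    · -- `D` a non-square: `b = c`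
      exact ⟨c, hcu, by rw [hcc]; exact hDsq⟩

/-! ## The exclusion: a fix-cover by non-square reflections -/

/-- The subgroup generated by the non-square reflections (`= Ω₃ ∪ −(SO₃ ∖ Ω₃) ≅ PGL₂(𝔽_p)` for
`m = 3`). -/
def reflGroup (p m : ℕ) [Fact p.Prime] : Subgroup (GLm p m) :=
  Subgroup.closure {g | ∃ b : Fin m → ZMod p, ¬ IsSquare (b ⬝ᵥ b) ∧ g = refl b}

/-- The non-square reflections of a member generate a subgroup of it. -/
theorem reflGroup_le {H : Subgroup (GLm p m)}
    (h : ∀ b : Fin m → ZMod p, ¬ IsSquare (b ⬝ᵥ b) → refl b ∈ H) : reflGroup p m ≤ H := by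
  refine (Subgroup.closure_le H).mpr ?_
  rintro _ ⟨b, hb, rfl⟩
  exact h b hb

section General

variable [NeZero m] {H₁ H₂ H₃ : Subgroup (GLm p m)}

/-- **GENERIC COVER FORM** (any `m ≥ 1`, `−1 ≠ 1`).  If every `u ≠ 0` of `𝔽_p^m` is orthogonal to
some `b` with `Q(b)` a non-square (so that the non-square reflection `R_b`, of determinant `−1`,
fixes `u`) and every non-trivial element of the group generated by the non-square reflections is
a triple product `a b g ∈ H₁ H₂ H₃`, then `(H₁, H₂, H₃)` carries no level-one identity design
(`GLmLevelOneCertificates.no_levelOne_design_of_detFixers_gl`). -/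
theorem no_design_of_fixCover (hm1' : (-1 : ZMod p) ≠ 1)
    (hcov : ∀ u : Fin m → ZMod p, u ≠ 0 → ∃ b : Fin m → ZMod p, b ⬝ᵥ u = 0 ∧ ¬ IsSquare (b ⬝ᵥ b))
    (hmem : ∀ k ∈ reflGroup p m, k ≠ 1 → ∃ a ∈ H₁, ∃ b ∈ H₂, ∃ g ∈ H₃, a * b * g = k) :
    ¬ ∃ c : Mat p m → ℂ, (∀ M, 1 < M.rank → c M = 0) ∧
      (∑ M, c M * ZMod.stdAddChar (Matrix.trace (M * ((1 : GLm p m) : Mat p m)))) = 1 ∧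
      ∀ a ∈ H₁, ∀ b ∈ H₂, ∀ g ∈ H₃, a * b * g ≠ 1 →
        (∑ M, c M * ZMod.stdAddChar (Matrix.trace (M * ((a * b * g : GLm p m) : Mat p m)))) = 0 := by
  refine no_levelOne_design_of_detFixers_gl (reflGroup p m) hmem fun u hu => ?_
  obtain ⟨b, hbu, hb⟩ := hcov u hu
  have hQ : b ⬝ᵥ b ≠ 0 := fun h => hb (by rw [h]; exact ⟨0, (mul_zero 0).symm⟩)
  refine ⟨refl b, Subgroup.subset_closure ⟨b, hb, rfl⟩, ?_, ?_⟩
  · rw [coe_refl, det_reflMat b hQ]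
    exact hm1'
  · rw [coe_refl]
    exact reflMat_mulVec b u hbu

end General

section GL3

variable {H₁ H₂ H₃ : Subgroup (GLm p 3)}

/-- **COVER FORM in `GL₃(𝔽_p)`** (`p ≡ 3 mod 4`).  If every non-trivial element of the group
generated by the non-square reflections of `𝔽_p³` is a triple product `a b g ∈ H₁ H₂ H₃`, then
`(H₁, H₂, H₃)` carries no level-one identity design. -/
theorem no_design_of_cover (hm1 : ¬ IsSquare (-1 : ZMod p))
    (hmem : ∀ k ∈ reflGroup p 3, k ≠ 1 → ∃ a ∈ H₁, ∃ b ∈ H₂, ∃ g ∈ H₃, a * b * g = k) :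
    ¬ ∃ c : Mat p 3 → ℂ, (∀ M, 1 < M.rank → c M = 0) ∧
      (∑ M, c M * ZMod.stdAddChar (Matrix.trace (M * ((1 : GLm p 3) : Mat p 3)))) = 1 ∧
      ∀ a ∈ H₁, ∀ b ∈ H₂, ∀ g ∈ H₃, a * b * g ≠ 1 →
        (∑ M, c M * ZMod.stdAddChar (Matrix.trace (M * ((a * b * g : GLm p 3) : Mat p 3)))) = 0 :=
  no_design_of_fixCover (neg_one_ne_one' hm1) (fun u hu => exists_orth_nonsquare hm1 u hu) hmem

/-- **No member contains all non-square reflections of `𝔽_p³`** (`p ≡ 3 mod 4`): member `1`. -/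
theorem no_design_mem₁ (hm1 : ¬ IsSquare (-1 : ZMod p))
    (h₁ : ∀ b : Fin 3 → ZMod p, ¬ IsSquare (b ⬝ᵥ b) → refl b ∈ H₁) :
    ¬ ∃ c : Mat p 3 → ℂ, (∀ M, 1 < M.rank → c M = 0) ∧
      (∑ M, c M * ZMod.stdAddChar (Matrix.trace (M * ((1 : GLm p 3) : Mat p 3)))) = 1 ∧
      ∀ a ∈ H₁, ∀ b ∈ H₂, ∀ g ∈ H₃, a * b * g ≠ 1 →
        (∑ M, c M * ZMod.stdAddChar (Matrix.trace (M * ((a * b * g : GLm p 3) : Mat p 3)))) = 0 :=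
  no_design_of_cover hm1 (triple_of_le₁ (reflGroup_le h₁))

/-- Member `2`. -/
theorem no_design_mem₂ (hm1 : ¬ IsSquare (-1 : ZMod p))
    (h₂ : ∀ b : Fin 3 → ZMod p, ¬ IsSquare (b ⬝ᵥ b) → refl b ∈ H₂) :
    ¬ ∃ c : Mat p 3 → ℂ, (∀ M, 1 < M.rank → c M = 0) ∧
      (∑ M, c M * ZMod.stdAddChar (Matrix.trace (M * ((1 : GLm p 3) : Mat p 3)))) = 1 ∧
      ∀ a ∈ H₁, ∀ b ∈ H₂, ∀ g ∈ H₃, a * b * g ≠ 1 →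
        (∑ M, c M * ZMod.stdAddChar (Matrix.trace (M * ((a * b * g : GLm p 3) : Mat p 3)))) = 0 :=
  no_design_of_cover hm1 (triple_of_le₂ (reflGroup_le h₂))

/-- Member `3`. -/
theorem no_design_mem₃ (hm1 : ¬ IsSquare (-1 : ZMod p))
    (h₃ : ∀ b : Fin 3 → ZMod p, ¬ IsSquare (b ⬝ᵥ b) → refl b ∈ H₃) :
    ¬ ∃ c : Mat p 3 → ℂ, (∀ M, 1 < M.rank → c M = 0) ∧
      (∑ M, c M * ZMod.stdAddChar (Matrix.trace (M * ((1 : GLm p 3) : Mat p 3)))) = 1 ∧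
      ∀ a ∈ H₁, ∀ b ∈ H₂, ∀ g ∈ H₃, a * b * g ≠ 1 →
        (∑ M, c M * ZMod.stdAddChar (Matrix.trace (M * ((a * b * g : GLm p 3) : Mat p 3)))) = 0 :=
  no_design_of_cover hm1 (triple_of_le₃ (reflGroup_le h₃))

end GL3

/-! ## Every dimension `m ≥ 3`: the reflections of three coordinates -/

section GLm

variable {l n : ℕ} (e : Fin 3 ⊕ Fin l ≃ Fin n) {H₁ H₂ H₃ : Subgroup (GLm p n)}

/-- **BLOCK COVER FORM in `GL_n(𝔽_p)`** (`p ≡ 3 mod 4`, any three coordinates). -/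
theorem no_design_of_blockCover (hm1 : ¬ IsSquare (-1 : ZMod p))
    (hmem : ∀ k ∈ reflGroup p 3, k ≠ 1 → ∃ a b g : GLm p 3, emb e a ∈ H₁ ∧ emb e b ∈ H₂ ∧
      emb e g ∈ H₃ ∧ a * b * g = k) :
    ¬ ∃ c : Mat p n → ℂ, (∀ M, 1 < M.rank → c M = 0) ∧
      (∑ M, c M * ZMod.stdAddChar (Matrix.trace (M * ((1 : GLm p n) : Mat p n)))) = 1 ∧
      ∀ a ∈ H₁, ∀ b ∈ H₂, ∀ g ∈ H₃, a * b * g ≠ 1 →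
        (∑ M, c M * ZMod.stdAddChar (Matrix.trace (M * ((a * b * g : GLm p n) : Mat p n)))) = 0 :=
  fun hdes => no_design_of_cover (H₁ := H₁.comap (emb e)) (H₂ := H₂.comap (emb e))
    (H₃ := H₃.comap (emb e)) hm1
    (fun k hk h1 => by
      obtain ⟨a, b, g, ha, hb, hg, h⟩ := hmem k hk h1
      exact ⟨a, Subgroup.mem_comap.mpr ha, b, Subgroup.mem_comap.mpr hb, g,
        Subgroup.mem_comap.mpr hg, h⟩)
    (design_comap e 1 hdes)

/-- **No member contains the non-square reflections of three coordinates** (`p ≡ 3 mod 4`, any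
`n ≥ 3`): member `1`. -/
theorem no_design_mem₁_all (hm1 : ¬ IsSquare (-1 : ZMod p))
    (h₁ : ∀ b : Fin 3 → ZMod p, ¬ IsSquare (b ⬝ᵥ b) → emb e (refl b) ∈ H₁) :
    ¬ ∃ c : Mat p n → ℂ, (∀ M, 1 < M.rank → c M = 0) ∧
      (∑ M, c M * ZMod.stdAddChar (Matrix.trace (M * ((1 : GLm p n) : Mat p n)))) = 1 ∧
      ∀ a ∈ H₁, ∀ b ∈ H₂, ∀ g ∈ H₃, a * b * g ≠ 1 →
        (∑ M, c M * ZMod.stdAddChar (Matrix.trace (M * ((a * b * g : GLm p n) : Mat p n)))) = 0 :=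
  fun hdes => no_design_mem₁ (H₁ := H₁.comap (emb e)) (H₂ := H₂.comap (emb e))
    (H₃ := H₃.comap (emb e)) hm1 (fun b hb => Subgroup.mem_comap.mpr (h₁ b hb))
    (design_comap e 1 hdes)

/-- Member `2`, any `n ≥ 3`. -/
theorem no_design_mem₂_all (hm1 : ¬ IsSquare (-1 : ZMod p))
    (h₂ : ∀ b : Fin 3 → ZMod p, ¬ IsSquare (b ⬝ᵥ b) → emb e (refl b) ∈ H₂) :
    ¬ ∃ c : Mat p n → ℂ, (∀ M, 1 < M.rank → c M = 0) ∧
      (∑ M, c M * ZMod.stdAddChar (Matrix.trace (M * ((1 : GLm p n) : Mat p n)))) = 1 ∧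
      ∀ a ∈ H₁, ∀ b ∈ H₂, ∀ g ∈ H₃, a * b * g ≠ 1 →
        (∑ M, c M * ZMod.stdAddChar (Matrix.trace (M * ((a * b * g : GLm p n) : Mat p n)))) = 0 :=
  fun hdes => no_design_mem₂ (H₁ := H₁.comap (emb e)) (H₂ := H₂.comap (emb e))
    (H₃ := H₃.comap (emb e)) hm1 (fun b hb => Subgroup.mem_comap.mpr (h₂ b hb))
    (design_comap e 1 hdes)

/-- Member `3`, any `n ≥ 3`. -/
theorem no_design_mem₃_all (hm1 : ¬ IsSquare (-1 : ZMod p))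
    (h₃ : ∀ b : Fin 3 → ZMod p, ¬ IsSquare (b ⬝ᵥ b) → emb e (refl b) ∈ H₃) :
    ¬ ∃ c : Mat p n → ℂ, (∀ M, 1 < M.rank → c M = 0) ∧
      (∑ M, c M * ZMod.stdAddChar (Matrix.trace (M * ((1 : GLm p n) : Mat p n)))) = 1 ∧
      ∀ a ∈ H₁, ∀ b ∈ H₂, ∀ g ∈ H₃, a * b * g ≠ 1 →
        (∑ M, c M * ZMod.stdAddChar (Matrix.trace (M * ((a * b * g : GLm p n) : Mat p n)))) = 0 :=
  fun hdes => no_design_mem₃ (H₁ := H₁.comap (emb e)) (H₂ := H₂.comap (emb e))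
    (H₃ := H₃.comap (emb e)) hm1 (fun b hb => Subgroup.mem_comap.mpr (h₃ b hb))
    (design_comap e 1 hdes)

end GLm

end NonsquareReflections
end Summit.MatrixMultiplication.MatrixMultiplication.Theorems.SubgroupIdentityDesigns.Negative

end
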